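import Summits.CriticalPhenomena.PercolationContinuityZ3.Theorems.PercNearOneGluingNoHeavyLowerTailFrontierDecRowsUnmarkedEdgeKeyOpen
import HarnessLib

/-!
# The KEY forms of an edge step, III: `E₃ ≥ 0` for ARBITRARY decreasing (increasing) events from the KEY form at every edge —
# the inductive form of Kahn's Conjecture 5 on graph-indexed cubes

Support file (prover seat `prim-bnk-1`, gen 9; `--supports stmt-CriticalPhenomena-4575`).  No definitions, no named facts, no sorries,
no `native_decide`.  Sequel of `…FrontierDecRowsUnmarkedEdgeKeyOpen` (one-bond KEY expansions) and of prim-l12-p1's `…FrontierDecRowsEdgeInduction`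
(edge induction from `B₁, B₂ ≥ 0` at every edge, WITHOUT induction hypotheses in the step).

**Theorem (`EdgeInduction.sahiE3_nonneg_of_edgeKey`).**  Let `A, B, C ⊆ BondConfig (Fin n)` be decreasing events (arbitrary — no pattern structure).
If for every weight `w` and every pair `e`, GIVEN `0 ≤ E₃` under `w[e↦0]` and under `w[e↦1]`, the KEY form is nonnegative,
`0 ≤ key μ_{w[e↦0]} μ_{w[e↦1]} A B C` (`K = 3B₁ − 2B₀ = T(0) + T'(0)`), then `0 ≤ E₃(A,B,C)` under `prodBernoulli w` for every `w`.
Proof: induction on the number of fractional pairs; the step is the one-bond KEY expansion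
`E₃(w) = (1−p)E₃(w⁰) + p²E₃(w¹) + p(1−p)K + p²(1−p)π_Aπ_Bπ_C` with `π ≥ 0` for decreasing events; the base is `E₃ = 0` at a point mass.
**`EdgeInduction.sahiE3_nonneg_of_edgeKeyOpen`**: the same for increasing events from the open-end form `K' = key μ_{w[e↦1]} μ_{w[e↦0]}`.

READING AND SCOPE.  Kahn's Conjecture 5 (tree: `KahnConjecture`, OPEN) asks `E₃ ≥ 0` for three monotone events of a product measure.  The hypothesis
here — "`K_e ≥ 0` at every pair `e`, given `E₃ ≥ 0` under both `w[e↦0]`, `w[e↦1]`" — is the first-order DELETION bound `E₃(w) ≥ (1 − w e)·E₃(w[e↦0]) + O((w e)²)`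
of part II, i.e. the termwise form `3B₁ ≥ 2B₀` of the cell's two-graph row DELMONO-E3 (prim-ineq-prove-2 gen 4, INEQ-CLAIMS.md; Bernstein form
`(1−p)²(3B₁−2B₀) + p(1−p)(3B₂−B₀) + p²B₃ ≥ 0`).  AS A UNIVERSAL STATEMENT over all decreasing triples it is FALSE: DELMONO-E3 is refuted exactly (prove-2 gen 5:
theta graph on 6 vertices, six-terminal separation triple, pair between two terminals, deficit `−2.95e−5`) and so is the abstract cube form DM₃ (ttrl cp-sahi2,
`{0,1}⁵`, `−1.45e−6`; true coefficientwise on `{0,1}^k`, `k ≤ 4`).  So this file is a SCHEMA to be applied triple by triple: for a specific `(A,B,C)` whose KEY forms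
are nonnegative at every pair (census, prim-bnk-1 gen 9, exact, random graphs `n ≤ 7`: the seven open four-point rows 12/15/27/30/36/37/44 and the theorem rows
3PT-LB / star / tree / hybrid have `K_e ≥ 0` at terminal–unmarked, unmarked–unmarked AND terminal–terminal pairs in every sampled instance; ttrl cp-key:
`7.0·10⁸` exhaustive terminal–unmarked instances, `n ≤ 7`, 0 negatives), `E₃ ≥ 0` follows on every finite weighted graph; the four-terminal pattern rows only need
the terminal–unmarked pairs (`TerminalEdgeInduction.frontier_all_of_keyHyp`, part I), this file records the pattern-free version.
Memo: run/shared/lean/prim/prim-l12/FROM-prim-bnk-1-gen9-KEY-DELETION-BOUND.md.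
-/

noncomputable section

namespace Summit.CriticalPhenomena.PercolationContinuityZ3.Theorems

namespace EdgeInduction

open MeasureTheory Literature.Probability.Percolation Literature.Probability.LatticeModels
open TerminalEdgeInduction
open scoped Classical

variable {n : ℕ}

/-- **`E₃ ≥ 0` for decreasing events from the KEY form at every edge (with induction hypotheses).** [this work] -/
theorem sahiE3_nonneg_of_edgeKey (A B C : Set (BondConfig (Fin n))) (hA : IsLowerSet A) (hB : IsLowerSet B) (hC : IsLowerSet C)
    (h : ∀ (w : Sym2 (Fin n) → unitInterval) (e : Sym2 (Fin n)),
      0 ≤ sahiE3 (prodBernoulli (Function.update w e 0)) A B C →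
      0 ≤ sahiE3 (prodBernoulli (Function.update w e 1)) A B C →
      0 ≤ key (prodBernoulli (Function.update w e 0)) (prodBernoulli (Function.update w e 1)) A B C) :
    ∀ w : Sym2 (Fin n) → unitInterval, 0 ≤ sahiE3 (prodBernoulli w) A B C := by
  suffices H : ∀ (k : ℕ) (w : Sym2 (Fin n) → unitInterval), (fracEdges w).card ≤ k → 0 ≤ sahiE3 (prodBernoulli w) A B C from
    fun w => H _ w le_rfl
  intro k
  induction k with
  | zero =>
      intro w hk
      have hw : ∀ e, w e = 0 ∨ w e = 1 := fun e =>
        eq_zero_or_one_of_not_mem_fracEdges (by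
          intro he
          have : 0 < (fracEdges w).card := Finset.card_pos.2 ⟨e, he⟩
          omega)
      rw [sahiE3_eq_zero_of_zeroOne w hw]
  | succ k ih =>
      intro w hk
      by_cases hempty : fracEdges w = ∅
      · have hw : ∀ e, w e = 0 ∨ w e = 1 := fun e => eq_zero_or_one_of_not_mem_fracEdges (by rw [hempty]; simp)
        rw [sahiE3_eq_zero_of_zeroOne w hw]
      · obtain ⟨e, he⟩ := Finset.nonempty_iff_ne_empty.2 hempty
        have hcard0 : (fracEdges (Function.update w e 0)).card ≤ k := by
          have h1 := Finset.card_le_card (fracEdges_update_subset w e 0 (Or.inl rfl))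
          rw [Finset.card_erase_of_mem he] at h1
          omega
        have hcard1 : (fracEdges (Function.update w e 1)).card ≤ k := by
          have h1 := Finset.card_le_card (fracEdges_update_subset w e 1 (Or.inr rfl))
          rw [Finset.card_erase_of_mem he] at h1
          omega
        have i0 := ih _ hcard0
        have i1 := ih _ hcard1
        have hK := h w e i0 i1
        have hp1 : (w e : ℝ) ≤ 1 := (w e).2.2
        have hq : (0 : ℝ) ≤ 1 - w e := sub_nonneg.2 hp1
        exact le_trans (mul_nonneg hq i0) (sahiE3_ge_deletion_of_key w e hA hB hC hK i1)

/-- **`E₃ ≥ 0` for increasing events from the open-end KEY form at every edge (with induction hypotheses).** [this work] -/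
theorem sahiE3_nonneg_of_edgeKeyOpen (A B C : Set (BondConfig (Fin n))) (hA : IsUpperSet A) (hB : IsUpperSet B) (hC : IsUpperSet C)
    (h : ∀ (w : Sym2 (Fin n) → unitInterval) (e : Sym2 (Fin n)),
      0 ≤ sahiE3 (prodBernoulli (Function.update w e 0)) A B C →
      0 ≤ sahiE3 (prodBernoulli (Function.update w e 1)) A B C →
      0 ≤ key (prodBernoulli (Function.update w e 1)) (prodBernoulli (Function.update w e 0)) A B C) :
    ∀ w : Sym2 (Fin n) → unitInterval, 0 ≤ sahiE3 (prodBernoulli w) A B C := by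
  suffices H : ∀ (k : ℕ) (w : Sym2 (Fin n) → unitInterval), (fracEdges w).card ≤ k → 0 ≤ sahiE3 (prodBernoulli w) A B C from
    fun w => H _ w le_rfl
  intro k
  induction k with
  | zero =>
      intro w hk
      have hw : ∀ e, w e = 0 ∨ w e = 1 := fun e =>
        eq_zero_or_one_of_not_mem_fracEdges (by
          intro he
          have : 0 < (fracEdges w).card := Finset.card_pos.2 ⟨e, he⟩
          omega)
      rw [sahiE3_eq_zero_of_zeroOne w hw]
  | succ k ih =>
      intro w hk
      by_cases hempty : fracEdges w = ∅
      · have hw : ∀ e, w e = 0 ∨ w e = 1 := fun e => eq_zero_or_one_of_not_mem_fracEdges (by rw [hempty]; simp)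
        rw [sahiE3_eq_zero_of_zeroOne w hw]
      · obtain ⟨e, he⟩ := Finset.nonempty_iff_ne_empty.2 hempty
        have hcard0 : (fracEdges (Function.update w e 0)).card ≤ k := by
          have h1 := Finset.card_le_card (fracEdges_update_subset w e 0 (Or.inl rfl))
          rw [Finset.card_erase_of_mem he] at h1
          omega
        have hcard1 : (fracEdges (Function.update w e 1)).card ≤ k := by
          have h1 := Finset.card_le_card (fracEdges_update_subset w e 1 (Or.inr rfl))
          rw [Finset.card_erase_of_mem he] at h1
          omega
        have i0 := ih _ hcard0
        have i1 := ih _ hcard1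
        have hK := h w e i0 i1
        have hp0 : (0 : ℝ) ≤ w e := (w e).2.1
        exact le_trans (mul_nonneg hp0 i1) (sahiE3_ge_contraction_of_keyOpen w e hA hB hC hK i0)

end EdgeInduction

end Summit.CriticalPhenomena.PercolationContinuityZ3.Theorems
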